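import Summits.NavierStokesRegularity.FunctionalMining.TopEigHeatConvex
import Summits.NavierStokesRegularity.FunctionalMining.TopEigHeatCoerciveGap
import Summits.NavierStokesRegularity.FunctionalMining.SecantDissipation
import Literature.Analysis.FunctionSpaces.TorusInverseLaplacianCalculus
import HarnessLib

/-!
# FunctionalMining/NoGo — the FINITE-DIMENSIONAL ALTERNATIVE for the heat coercivity of `∫(λ₁⁺)^q`:
# inside any finite family of smooth fields, EITHER some nonzero combination has no first-order heat
# decay at all, OR the core is uniformly heat-coercive on the whole family (compactness)

search for candidate a priori estimates; no regularity claim. Cell `pub-nsfunc`, NO-GO seat (gen 50,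
touch 5), kernel companion of escape door (b) = (F2) of `NOGO.md` (the WANTED kernel refutation
`¬ TopEigHeatCoercivePos q`, `1 < q`, equivalently `topEigHeatRate q = 0`, tree `TopEigHeatRate`).
Every (F2) design typed so far lives in a FINITE-DIMENSIONAL linear family of smooth fields (two
shells `u + s • w`, tree `NoGo.TopEigHeatTwoShell`; three shells; translation / calibration classes
of fixed modes, staged K42–K45): the witness SEQUENCE is sought by tuning finitely many real
coefficients. This file proves, with proof and no numerics, the structural obstruction behind the
recorded failures of that search:

* **`TopEig.finiteFamily_heat_alternative`** — for `1 ≤ q`, any finite index type `ι` and smooth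
  fields `b : ι → (T^d → ℝ^d)`, writing `v_a := ∑ i, a i • b i` (`a : ι → ℝ`): EITHER
  `∃ a ≠ 0, heatDissipation (∫(λ₁⁺)^q) v_a ≤ 0` (a nonzero member of the family along which the
  core has NO first-order decay under the heat flow — for `d = 3` div-free members this forces
  `heatDissipation = 0`, `TopEig.finiteFamily_heat_alternative_divFree`), OR
  `∃ ε > 0, ∀ a, ε · ∫(λ₁⁺)^q(v_a) ≤ heatDissipation (∫(λ₁⁺)^q) v_a` (UNIFORM coercivity on the
  family).
* **`TopEig.finiteFamily_exact_of_rates_to_zero`** — contrapositive, the form the (F2) hunt meets: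
  if the family defeats every rate (`∀ ε > 0, ∃ a, heatDissipation < ε · Φ`), then it already
  contains an EXACT non-dissipating nonzero member. A minimising SEQUENCE inside a fixed finite
  family never certifies `topEigHeatRate q = 0` unless an exact witness sits in the family; (F2)
  witnesses must be spectrally unbounded (infinitely many shells) or exact.

Mechanism (all kernel-checked here): `a ↦ S(v_a)(x)`, `a ↦ Δv_a` are linear (tree
`TopEig.strainFlat_add_smul`, `Torus.laplacian_add_apply`); `a ↦ ∫(λ₁⁺)^q(v_a)` is CONTINUOUS (joint
continuity of `(a, x) ↦ (λ(∑ aᵢ S(bᵢ)(x))⁺)^q`, tree `TopEig.continuous_lam`, Mathlib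
`continuous_parametric_integral_of_continuous` on the compact torus); the heat line of the family is
the family of the `bᵢ + tΔbᵢ`, so every heat secant is continuous in `a` and
`a ↦ heatDissipation Φ v_a = sup_t secant` is LOWER SEMICONTINUOUS (`lowerSemicontinuous_ciSup`;
secants bounded by convexity, tree `TopEig.convexOn_topEigMoment_line`,
`SecantA.bddAbove_fwd_secant`); `Φ` and `heatDissipation Φ` are `q`-HOMOGENEOUS (tree
`TopEig.torusTopEigMoment_smul`, `Torus.laplacian_const_smul_apply`); on the compact unit sphere of
coefficients a positive lsc function has a positive minimum, a continuous one a maximum.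

Placement: imports the BUILT tree files `TopEigHeatConvex`, `TopEigHeatCoerciveGap`,
`SecantDissipation` and the Literature torus calculus only; no `sorry`, no new axioms, no
`Literature/` edit; nothing here is a regularity statement, a BKM/CKN criterion or a claim about
Navier–Stokes solutions, and it moves no verdict (L-λ(q) stays OPEN (kernel) for every real
`q > 1`). [ours — finite-dimensional compactness alternative for static heat coercivity; folklore
ingredients]
FILING (prove seat g29, REQUEST #72): declarations byte-identical to the no-go seat's staged `TopEigHeatFiniteDim.STAGING.lean` 325ddf262b33a1b7; this line is the only addition.
-/

noncomputable section

open MeasureTheory Set Filter Topology Finset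

namespace Summit.NavierStokesRegularity.FunctionalMining

open Literature.Analysis.FunctionSpaces Literature.Analysis.FluidPDE

namespace TopEig

variable {d : Type*} [Fintype d] [DecidableEq d] [Nonempty d]
variable {ι : Type*} [Fintype ι] {b : ι → UnitAddTorus d → EuclideanSpace ℝ d}

/-! ## 1. Finite linear combinations of smooth fields: smoothness, strain, Laplacian, heat line -/

omit [DecidableEq d] [Nonempty d] [Fintype ι] in
/-- A finite linear combination of smooth fields is smooth. [folklore] -/
theorem isSmooth_finsetSum_smul (hb : ∀ i, Torus.IsSmooth (b i)) (a : ι → ℝ) (s : Finset ι) :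
    Torus.IsSmooth (∑ i ∈ s, a i • b i) := by
  induction s using Finset.cons_induction with
  | empty =>
    rw [sum_empty]
    exact Torus.isSmooth_const (0 : EuclideanSpace ℝ d)
  | cons i s hi ih =>
    rw [sum_cons]
    exact (Torus.IsSmooth.smul (a i) (hb i)).add ih

omit [Nonempty d] [Fintype ι] in
/-- A finite linear combination of smooth divergence-free fields is divergence free. [folklore] -/
theorem isDivFree_finsetSum_smul (hb : ∀ i, Torus.IsSmooth (b i))
    (hdiv : ∀ i, Torus.IsDivFree (b i)) (a : ι → ℝ) (s : Finset ι) :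
    Torus.IsDivFree (∑ i ∈ s, a i • b i) := by
  induction s using Finset.cons_induction with
  | empty =>
    rw [sum_empty]
    intro x
    simp [Torus.divergence, Torus.partialDeriv, Torus.lineDeriv]
  | cons i s hi ih =>
    rw [sum_cons, add_comm]
    exact isDivFree_add_smul (isSmooth_finsetSum_smul hb a s) (hb i) ih (hdiv i) (a i)

omit [Nonempty d] in
/-- The flattened strain of the zero field vanishes. [folklore] -/
theorem strainFlat_zero_field (x : UnitAddTorus d) :
    StrainL4.strainFlat (0 : UnitAddTorus d → EuclideanSpace ℝ d) x = 0 := by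
  ext p
  simp [StrainL4.strainFlat_apply, Torus.partialDeriv, Torus.lineDeriv]

omit [Nonempty d] [Fintype ι] in
/-- **Linearity of the strain on a finite family**: `S(∑ aᵢ bᵢ)(x) = ∑ aᵢ S(bᵢ)(x)`. [folklore] -/
theorem strainFlat_finsetSum_smul (hb : ∀ i, Torus.IsSmooth (b i)) (a : ι → ℝ) (s : Finset ι)
    (x : UnitAddTorus d) :
    StrainL4.strainFlat (∑ i ∈ s, a i • b i) x = ∑ i ∈ s, a i • StrainL4.strainFlat (b i) x := by
  induction s using Finset.cons_induction with
  | empty =>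
    rw [sum_empty, sum_empty]
    exact strainFlat_zero_field x
  | cons i s hi ih =>
    rw [sum_cons, sum_cons, add_comm (a i • b i),
      strainFlat_add_smul ((isSmooth_finsetSum_smul hb a s).isContDiff (by simp))
        ((hb i).isContDiff (by simp)) (a i) x, ih, add_comm]

omit [DecidableEq d] [Nonempty d] in
/-- The Laplacian of the zero field vanishes. [folklore] -/
theorem laplacian_zero_field :
    Torus.laplacian (0 : UnitAddTorus d → EuclideanSpace ℝ d) = 0 := by
  funext x
  have h :=
    Torus.laplacian_const_smul_apply (Torus.isSmooth_const (0 : EuclideanSpace ℝ d)) (0 : ℝ) x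
  rw [zero_smul, zero_smul] at h
  exact h

omit [Nonempty d] [Fintype ι] in
/-- **Linearity of the Laplacian on a finite family**: `Δ(∑ aᵢ bᵢ) = ∑ aᵢ Δbᵢ`. [folklore] -/
theorem laplacian_finsetSum_smul (hb : ∀ i, Torus.IsSmooth (b i)) (a : ι → ℝ) (s : Finset ι) :
    Torus.laplacian (∑ i ∈ s, a i • b i) = ∑ i ∈ s, a i • Torus.laplacian (b i) := by
  induction s using Finset.cons_induction with
  | empty =>
    rw [sum_empty, sum_empty]
    exact laplacian_zero_field
  | cons i s hi ih =>
    funext x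
    rw [sum_cons, sum_cons,
      Literature.Analysis.FunctionSpaces.Torus.laplacian_add_apply
        (Torus.IsSmooth.smul (a i) (hb i)) (isSmooth_finsetSum_smul hb a s),
      Torus.laplacian_const_smul_apply (hb i) (a i) x, ih]
    simp only [Pi.add_apply, Pi.smul_apply]

omit [Nonempty d] in
/-- **The heat line of the family is a family**: `v_a + tΔv_a = ∑ aᵢ (bᵢ + tΔbᵢ)`.
[ours, bookkeeping] -/
theorem heatLine_sum_smul (hb : ∀ i, Torus.IsSmooth (b i)) (a : ι → ℝ) (t : ℝ) :
    (∑ i, a i • b i) + t • Torus.laplacian (∑ i, a i • b i) =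
      ∑ i, a i • (b i + t • Torus.laplacian (b i)) := by
  rw [laplacian_finsetSum_smul hb a univ, smul_sum, ← sum_add_distrib]
  refine sum_congr rfl fun i _ => ?_
  rw [smul_add, smul_comm t (a i)]

omit [Fintype d] [DecidableEq d] [Nonempty d] in
/-- Scaling the coefficients scales the field: `v_{r • a} = r • v_a`. [folklore] -/
theorem sum_smul_smul_coeff (a : ι → ℝ) (r : ℝ) :
    ∑ i, (r • a) i • b i = r • ∑ i, a i • b i := by
  rw [smul_sum]
  refine sum_congr rfl fun i _ => ?_
  rw [Pi.smul_apply, smul_eq_mul, mul_smul]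

/-! ## 2. Continuity of `a ↦ ∫(λ₁⁺)^q(v_a)` and lower semicontinuity of `a ↦ heatDissipation` -/

/-- `∫(λ₁⁺)^q` of a member of the family as a parametric integral in the coefficients.
[ours, bookkeeping] -/
theorem topEigMoment_sum_smul_eq (hb : ∀ i, Torus.IsSmooth (b i)) (a : ι → ℝ) (q : ℝ) :
    torusTopEigMoment q (∑ i, a i • b i) =
      ∫ x, max (lam (∑ i, a i • StrainL4.strainFlat (b i) x)) 0 ^ q := by
  unfold torusTopEigMoment
  refine integral_congr_ae (ae_of_all _ fun x => ?_)
  show max (torusStrainTopEig _ x) 0 ^ q = _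
  rw [← lam_strainFlat, strainFlat_finsetSum_smul hb a univ x]

/-- Joint continuity of the integrand `(a, x) ↦ (λ(∑ aᵢ S(bᵢ)(x))⁺)^q` (`0 ≤ q`). [folklore] -/
theorem continuous_topEig_integrand (hb : ∀ i, Torus.IsSmooth (b i)) {q : ℝ} (hq : 0 ≤ q) :
    Continuous (Function.uncurry fun (a : ι → ℝ) (x : UnitAddTorus d) =>
      max (lam (∑ i, a i • StrainL4.strainFlat (b i) x)) 0 ^ q) := by
  have hsum : Continuous fun p : (ι → ℝ) × UnitAddTorus d =>
      ∑ i, p.1 i • StrainL4.strainFlat (b i) p.2 :=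
    continuous_finsetSum _ fun i _ =>
      ((continuous_apply i).comp continuous_fst).smul
        ((StrainL4.continuous_strainFlat (hb i)).comp continuous_snd)
  exact ((continuous_lam.comp hsum).max continuous_const).rpow_const fun _ => Or.inr hq

/-- **`a ↦ ∫(λ₁⁺)^q(v_a)` is continuous** on the coefficient space (`0 ≤ q`): a parametric integral
with jointly continuous integrand over the compact torus. [ours; Mathlib
`continuous_parametric_integral_of_continuous`] -/
theorem continuous_topEigMoment_sum_smul (hb : ∀ i, Torus.IsSmooth (b i)) {q : ℝ} (hq : 0 ≤ q) :
    Continuous fun a : ι → ℝ => torusTopEigMoment q (∑ i, a i • b i) := by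
  have h := continuous_parametric_integral_of_continuous
    (μ := (volume : Measure (UnitAddTorus d))) (continuous_topEig_integrand hb hq) isCompact_univ
  simp only [Measure.restrict_univ] at h
  exact h.congr fun a => (topEigMoment_sum_smul_eq hb a q).symm

/-- **Every heat secant is continuous in the coefficients** (`0 ≤ q`):
`a ↦ (Φ(v_a) − Φ(v_a + tΔv_a))/t`. [ours] -/
theorem continuous_heatSecant_sum_smul (hb : ∀ i, Torus.IsSmooth (b i)) {q : ℝ} (hq : 0 ≤ q)
    (t : ℝ) :
    Continuous fun a : ι → ℝ =>
      (torusTopEigMoment q (∑ i, a i • b i) -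
        torusTopEigMoment q ((∑ i, a i • b i) + t • Torus.laplacian (∑ i, a i • b i))) / t := by
  have hb' : ∀ i, Torus.IsSmooth (b i + t • Torus.laplacian (b i)) := fun i =>
    (hb i).add (Torus.IsSmooth.smul t (hb i).laplacian)
  have h2 : Continuous fun a : ι → ℝ =>
      torusTopEigMoment q ((∑ i, a i • b i) + t • Torus.laplacian (∑ i, a i • b i)) :=
    (continuous_topEigMoment_sum_smul hb' hq).congr fun a => by rw [heatLine_sum_smul hb a t]
  exact ((continuous_topEigMoment_sum_smul hb hq).sub h2).div_const t

/-- **`a ↦ heatDissipation (∫(λ₁⁺)^q) v_a` is lower semicontinuous** (`1 ≤ q`): a supremum of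
continuous secants, bounded by convexity along heat lines. [ours] -/
theorem lowerSemicontinuous_heatDissipation_sum_smul (hb : ∀ i, Torus.IsSmooth (b i)) {q : ℝ}
    (hq : 1 ≤ q) :
    LowerSemicontinuous fun a : ι → ℝ =>
      heatDissipation (torusTopEigMoment q) (∑ i, a i • b i) := by
  unfold heatDissipation
  refine lowerSemicontinuous_ciSup (fun a => ?_) fun t =>
    (continuous_heatSecant_sum_smul hb (by linarith) (t : ℝ)).lowerSemicontinuous
  have hv := isSmooth_finsetSum_smul hb a univ
  simpa only [zero_smul, add_zero] using
    SecantA.bddAbove_fwd_secant (convexOn_topEigMoment_line hq hv hv.laplacian)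

/-! ## 3. `q`-homogeneity of the core and of its heat dissipation -/

/-- **`heatDissipation (∫(λ₁⁺)^q) (r • v) = r^q · heatDissipation (∫(λ₁⁺)^q) v`** for `r ≥ 0` and
smooth `v` (`Δ(r v) = r Δv`, `Φ(r w) = r^q Φ(w)` on every point of the heat line). The tree's
`TopEig.heatDissipation_topEigMoment_smul` (`TopEigScaling`, hypothesis `0 < a`) is the positive
case; restated for `0 ≤ r` (the zero member needs `r = 0`) without importing the transport stack.
[ours, bookkeeping] -/
theorem heatDissipation_topEigMoment_smul_of_nonneg {q : ℝ} {r : ℝ} (hr : 0 ≤ r)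
    {v : UnitAddTorus d → EuclideanSpace ℝ d} (hv : Torus.IsSmooth v) :
    heatDissipation (torusTopEigMoment q) (r • v) =
      r ^ q * heatDissipation (torusTopEigMoment q) v := by
  unfold heatDissipation
  rw [Real.mul_iSup_of_nonneg (Real.rpow_nonneg hr q)]
  refine iSup_congr fun t => ?_
  have hΔ : Torus.laplacian (r • v) = r • Torus.laplacian v :=
    funext fun x => Torus.laplacian_const_smul_apply hv r x
  have hw : Torus.IsSmooth (v + (t : ℝ) • Torus.laplacian v) :=
    hv.add (Torus.IsSmooth.smul (t : ℝ) hv.laplacian)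
  rw [hΔ, smul_comm (t : ℝ) r, ← smul_add, torusTopEigMoment_smul q hr hv,
    torusTopEigMoment_smul q hr hw]
  ring

/-- The zero member: `Φ(v_0) = 0` and `heatDissipation Φ v_0 = 0` (`q ≠ 0`). [ours, bookkeeping] -/
theorem topEigMoment_heatDissipation_sum_zero (hb : ∀ i, Torus.IsSmooth (b i)) {q : ℝ}
    (hq : q ≠ 0) :
    torusTopEigMoment q (∑ i, (0 : ι → ℝ) i • b i) = 0 ∧
      heatDissipation (torusTopEigMoment q) (∑ i, (0 : ι → ℝ) i • b i) = 0 := by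
  classical
  have hv := isSmooth_finsetSum_smul hb (0 : ι → ℝ) univ
  have h0 : (∑ i, (0 : ι → ℝ) i • b i) = (0 : ℝ) • ∑ i, (0 : ι → ℝ) i • b i := by
    rw [← sum_smul_smul_coeff (b := b) 0 0, smul_zero]
  refine ⟨?_, ?_⟩
  · rw [h0, torusTopEigMoment_smul q le_rfl hv, Real.zero_rpow hq, zero_mul]
  · rw [h0, heatDissipation_topEigMoment_smul_of_nonneg le_rfl hv, Real.zero_rpow hq, zero_mul]

/-! ## 4. The finite-dimensional alternative -/

/-- **FINITE-DIMENSIONAL ALTERNATIVE (compactness no-go for finite (F2) designs).** For `1 ≤ q`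
and a finite family of smooth fields `b`, EITHER some NONZERO combination `v_a = ∑ aᵢ bᵢ` has
`heatDissipation (∫(λ₁⁺)^q) v_a ≤ 0` (no first-order heat decay of the core at all), OR there is ONE
rate `ε > 0` with `ε · ∫(λ₁⁺)^q(v_a) ≤ heatDissipation (∫(λ₁⁺)^q) v_a` for EVERY `a`. Proof: if
every nonzero member dissipates, the lower semicontinuous `a ↦ heatDissipation` has a positive
minimum `m` on the compact unit sphere of coefficients and the continuous `a ↦ Φ(v_a)` a maximum `M`
there; `q`-homogeneity of both transports `ε := m / max M 1` to all `a`. [ours] -/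
theorem finiteFamily_heat_alternative {q : ℝ} (hq : 1 ≤ q) (hb : ∀ i, Torus.IsSmooth (b i)) :
    (∃ a : ι → ℝ, a ≠ 0 ∧ heatDissipation (torusTopEigMoment q) (∑ i, a i • b i) ≤ 0) ∨
      ∃ ε : ℝ, 0 < ε ∧ ∀ a : ι → ℝ,
        ε * torusTopEigMoment q (∑ i, a i • b i) ≤
          heatDissipation (torusTopEigMoment q) (∑ i, a i • b i) := by
  classical
  by_cases hex : ∃ a : ι → ℝ, a ≠ 0 ∧ heatDissipation (torusTopEigMoment q) (∑ i, a i • b i) ≤ 0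
  · exact Or.inl hex
  right
  push Not at hex
  have hq0 : q ≠ 0 := by linarith
  set Φf : (ι → ℝ) → ℝ := fun a => torusTopEigMoment q (∑ i, a i • b i) with hΦf
  set Df : (ι → ℝ) → ℝ := fun a => heatDissipation (torusTopEigMoment q) (∑ i, a i • b i) with hDf
  have hΦc : Continuous Φf := continuous_topEigMoment_sum_smul hb (by linarith)
  have hDl : LowerSemicontinuous Df := lowerSemicontinuous_heatDissipation_sum_smul hb hq
  -- the zero member
  have hzero : Φf 0 = 0 ∧ Df 0 = 0 := topEigMoment_heatDissipation_sum_zero hb hq0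
  -- homogeneity on the family
  have hΦhom : ∀ (a : ι → ℝ) (r : ℝ), 0 ≤ r → Φf (r • a) = r ^ q * Φf a := fun a r hr => by
    simp only [hΦf, sum_smul_smul_coeff]
    exact torusTopEigMoment_smul q hr (isSmooth_finsetSum_smul hb a univ)
  have hDhom : ∀ (a : ι → ℝ) (r : ℝ), 0 ≤ r → Df (r • a) = r ^ q * Df a := fun a r hr => by
    simp only [hDf, sum_smul_smul_coeff]
    exact heatDissipation_topEigMoment_smul_of_nonneg hr (isSmooth_finsetSum_smul hb a univ)
  -- the compact unit sphere of coefficients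
  set K : Set (ι → ℝ) := Metric.sphere (0 : ι → ℝ) 1 with hK
  have hKc : IsCompact K := isCompact_sphere 0 1
  by_cases hKne : K.Nonempty
  · -- minimum of the dissipation, maximum of the core on `K`
    obtain ⟨a₀, ha₀K, ha₀min⟩ := (hDl.lowerSemicontinuousOn K).exists_isMinOn hKne hKc
    obtain ⟨a₁, ha₁K, ha₁max⟩ := hKc.exists_isMaxOn hKne hΦc.continuousOn
    have ha₀ne : a₀ ≠ 0 := by
      intro h
      rw [h, hK, Metric.mem_sphere, dist_self] at ha₀K
      exact zero_ne_one ha₀K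
    have hm : 0 < Df a₀ := hex a₀ ha₀ne
    set M : ℝ := max (Φf a₁) 1 with hM
    have hM0 : 0 < M := lt_of_lt_of_le one_pos (le_max_right _ _)
    refine ⟨Df a₀ / M, div_pos hm hM0, fun a => ?_⟩
    by_cases ha : a = 0
    · subst ha
      show Df a₀ / M * Φf 0 ≤ Df 0
      rw [hzero.1, hzero.2, mul_zero]
    -- normalise `a = ‖a‖ • a'` with `a' ∈ K`
    have hna : 0 < ‖a‖ := norm_pos_iff.mpr ha
    set a' : ι → ℝ := ‖a‖⁻¹ • a with ha'
    have ha'K : a' ∈ K := by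
      rw [hK, Metric.mem_sphere, dist_zero_right, ha', norm_smul, norm_inv, norm_norm,
        inv_mul_cancel₀ hna.ne']
    have haa : a = ‖a‖ • a' := by rw [ha', smul_smul, mul_inv_cancel₀ hna.ne', one_smul]
    have hΦa : Φf a = ‖a‖ ^ q * Φf a' := by
      conv_lhs => rw [haa]
      exact hΦhom a' ‖a‖ hna.le
    have hDa : Df a = ‖a‖ ^ q * Df a' := by
      conv_lhs => rw [haa]
      exact hDhom a' ‖a‖ hna.le
    have hΦle : Φf a' ≤ M := le_trans (ha₁max ha'K) (le_max_left _ _)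
    have hDge : Df a₀ ≤ Df a' := ha₀min ha'K
    have hrq : 0 ≤ ‖a‖ ^ q := Real.rpow_nonneg hna.le q
    show Df a₀ / M * Φf a ≤ Df a
    rw [hΦa, hDa]
    calc Df a₀ / M * (‖a‖ ^ q * Φf a') ≤ Df a₀ / M * (‖a‖ ^ q * M) := by gcongr
      _ = ‖a‖ ^ q * Df a₀ := by field_simp
      _ ≤ ‖a‖ ^ q * Df a' := by gcongr
  · -- `K = ∅`: the coefficient space is trivial, every `a` is `0`
    refine ⟨1, one_pos, fun a => ?_⟩
    have ha : a = 0 := by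
      by_contra ha
      have hna : 0 < ‖a‖ := norm_pos_iff.mpr ha
      refine hKne ⟨‖a‖⁻¹ • a, ?_⟩
      rw [hK, Metric.mem_sphere, dist_zero_right, norm_smul, norm_inv, norm_norm,
        inv_mul_cancel₀ hna.ne']
    subst ha
    show 1 * Φf 0 ≤ Df 0
    rw [hzero.1, hzero.2, mul_zero]

/-- **Contrapositive — the form the (F2) hunt meets.** If a finite family of smooth fields defeats
EVERY rate (`∀ ε > 0, ∃ a, heatDissipation Φ v_a < ε Φ(v_a)`), then the family already contains a
NONZERO member with `heatDissipation Φ v_a ≤ 0`: a rate-killing minimising sequence inside a fixed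
finite-dimensional design exists only next to an EXACT non-dissipating member. [ours] -/
theorem finiteFamily_exact_of_rates_to_zero {q : ℝ} (hq : 1 ≤ q) (hb : ∀ i, Torus.IsSmooth (b i))
    (hkill : ∀ ε : ℝ, 0 < ε → ∃ a : ι → ℝ,
      heatDissipation (torusTopEigMoment q) (∑ i, a i • b i) <
        ε * torusTopEigMoment q (∑ i, a i • b i)) :
    ∃ a : ι → ℝ, a ≠ 0 ∧ heatDissipation (torusTopEigMoment q) (∑ i, a i • b i) ≤ 0 := by
  rcases finiteFamily_heat_alternative hq hb with h | ⟨ε, hε, hcoer⟩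
  · exact h
  · obtain ⟨a, ha⟩ := hkill ε hε
    exact absurd (hcoer a) (not_le.mpr ha)

/-- **Div-free packaging on `T³`.** For a finite family of smooth DIVERGENCE-FREE fields on `T³`
every member has `0 ≤ heatDissipation (∫(λ₁⁺)^q)` (tree `heatDissipation_nonneg_of_admissible`), so
the first branch of the alternative is an EXACT ZERO of the dissipation: either
`∃ a ≠ 0, heatDissipation Φ v_a = 0`, or the core is uniformly coercive on the family. [ours] -/
theorem finiteFamily_heat_alternative_divFree {q : ℝ} (hq : 1 ≤ q)
    {b : ι → UnitAddTorus (Fin 3) → EuclideanSpace ℝ (Fin 3)}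
    (hb : ∀ i, Torus.IsSmooth (b i)) (hdiv : ∀ i, Torus.IsDivFree (b i)) :
    (∃ a : ι → ℝ, a ≠ 0 ∧ heatDissipation (torusTopEigMoment q) (∑ i, a i • b i) = 0) ∨
      ∃ ε : ℝ, 0 < ε ∧ ∀ a : ι → ℝ,
        ε * torusTopEigMoment q (∑ i, a i • b i) ≤
          heatDissipation (torusTopEigMoment q) (∑ i, a i • b i) := by
  classical
  rcases finiteFamily_heat_alternative hq hb with ⟨a, ha, hle⟩ | h
  · refine Or.inl ⟨a, ha, le_antisymm hle ?_⟩
    have hv : Torus.IsSmooth (∑ i, a i • b i) := isSmooth_finsetSum_smul hb a univ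
    have hdv : Torus.IsDivFree (∑ i, a i • b i) := isDivFree_finsetSum_smul hb hdiv a univ
    exact heatDissipation_nonneg_of_admissible hq convexOn_lam lipschitzWith_lam
      (fun _ hv hdiv x => lam_strainFlat_nonneg hv hdiv x)
      (fun _ hv hdiv => torusTopEigMoment_eq hv hdiv q) hv hdv
  · exact Or.inr h

/-- **An EXACT member is an (F2) witness.** A smooth divergence-free zero-mean field on `T³` with
`∫(λ₁⁺)^q > 0` and `heatDissipation (∫(λ₁⁺)^q) v = 0` refutes `TopEigHeatCoercivePos q` outright
(`c · Φ ≤ 0` with `c, Φ > 0`). With `finiteFamily_heat_alternative_divFree`: a finite div-free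
zero-mean design on `T³` that defeats every rate contains such a member or a `Φ`-null nonzero
member. [ours, bookkeeping] -/
theorem not_topEigHeatCoercivePos_of_exact {q : ℝ}
    {v : UnitAddTorus (Fin 3) → EuclideanSpace ℝ (Fin 3)} (hv : Torus.IsSmooth v)
    (hdiv : Torus.IsDivFree v) (hzm : Torus.HasZeroMean v) (hΦ : 0 < torusTopEigMoment q v)
    (hD : heatDissipation (torusTopEigMoment q) v = 0) :
    ¬ TopEigHeatCoercivePos (d := Fin 3) q := by
  rintro ⟨c, hc, hcoer⟩
  have h := hcoer (by simp) v hv hdiv hzm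
  rw [hD] at h
  nlinarith

end TopEig

end Summit.NavierStokesRegularity.FunctionalMining

-- search for candidate a priori estimates; no regularity claim
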